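import Summits.BirchSwinnertonDyer.BirchSwinnertonDyer.Theorems.ThetaPartnerAtTwoSignedControlAtTwoShaThreeBaseCorTransfer
import Summits.BirchSwinnertonDyer.BirchSwinnertonDyer.Theorems.ThetaPartnerAtTwoSignedControlAtTwoShaThreeBaseGysinTwo
import Summits.BirchSwinnertonDyer.BirchSwinnertonDyer.Theorems.ThetaPartnerAtTwoSignedControlAtTwoShaThreeBaseTransferTwo
import Literature.NumberTheory.GaloisRepresentations.CorestrictionTransferComparison
import Mathlib.GroupTheory.OrderOfElement
import Mathlib.NumberTheory.NumberField.InfinitePlace.TotallyRealComplex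
import HarnessLib

/-!
# K4 `SignedControlAtTwo`, base case of Milne I Thm. 4.10 (c)₃: ASSEMBLY of the `hbase` road — the registered stub
# `stub_realThreeOrderTwoBase` from ONE displayed binder «every real-trivial class of `H²(F, T)` dies on some `Γ_{F(√e)}`, `e ≫ 0`»

Route `ThetaPartnerAtTwo` (TP2), crux K4 `SignedControlAtTwo` (stmt-BirchSwinnertonDyer-20309), line `eulerchar` v15, stub
`stub_realThreeOrderTwoBase` (the lead's binder `hbase`: for every number field `F` and every discrete `Γ_F`-module `T` of order
`2` with TRIVIAL action, `H³(F, T) → ⊕_{w real} H³(F_w, T)` is injective); extra width seat `bsd-wall-tp2-p3-w5` gen 0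
(`--supports stmt-BirchSwinnertonDyer-20309`, helper; assembly lane assigned by the lead 2026-08-28T11:03Z).

The sibling bricks of the road `Cruxes/SignedControlAtTwo/HBASE-ROAD-w2g7.md` are (all landed, all in this namespace):
`…ShaThreeBaseImaginary.realThree_injective_of_norm_imaginary` (hbase ⟸ NORM at `Γ_{F(√-1)}`), `…ShaThreeBaseGysinTwo`
(`mem_range_cor_of_resH_two_eq_zero`: a class dying on an open index-`2` subgroup `U` with `χ_U ∈ cor_{S'} H¹(S', ℤ/2)` is a
corestriction from `S'`), `…ShaThreeBaseTransferTwo.cor_quadraticKummer_eq` (`cor_{Γ_{F(δ)}} κ(δ) = κ(-δ²)`), and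
`…ShaThreeBaseCorTransfer.range_cor_galFixing_adjoin_subset_of_neg` (B7: corestrictions from `Γ_{F(√a)}`, `a` totally negative,
are corestrictions from `Γ_{F(√-1)}`).  This file COMPOSES them:

* `mem_range_cor_of_resH_galFixing_eq_zero` — if `y ∈ H²(F, T)` dies on `Γ_{F(ε)}` (`ε² = e ∈ F`, `ε ∉ F`) and `Iε ∉ F`
  (`I² = -1`), then `y ∈ cor(H²(Γ_{F(Iε)}, T))` (Gysin + quadratic transfer with `δ = Iε`, `δ² = -e`, `κ(-δ²) = κ(e) = χ_U`).
* **`realThree_injective_orderTwo_of_dies`** — `hbase(F, T)` GRANTED the displayed binder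
  (hDie)(F, T): every real-trivial `y ∈ H²(F, T)` dies on `Γ_{F(√e)}` for SOME totally positive non-square `e ∈ F` (depending on
  `y`).  (Totally complex `F`: `cd₂(Γ_F) ≤ 2`; otherwise `-e < 0` at every real embedding, so `F(Iε)` is totally complex,
  `cd₂ ≤ 2`, and B7 moves the norm to `Γ_{F(√-1)}`.)
* **`stub_realThreeOrderTwoBase_of_dies`** — the registered stub signature VERBATIM (all `F`, all `T` with `Nat.card T = 2`) from
  `∀ F T, (hDie)(F, T)`; `2T = 0` is read off `Nat.card T = 2`.

What (hDie) still needs from the road (owner w2 g7, bricks B2 `…ShaThreeBaseKilling` + B3): the finite support of `y` (landed ×3),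
an `e ≫ 0` that is a non-square with `e ∉ F_v²` on the support (B3), and the `μ₂ ↔ T` / Kummer-injectivity glue turning
`resH_kummer_eq_zero_of_dvd_localIndex` into `resH (Γ_{F(√e)}) σT 2 y = 0`.
HONEST FRAMING: THEOREMS ONLY (no definition, no named fact, no `sorry`); closes no item by itself; BSD is not proved by any of this.
References: [MilneADT2006] I Thm. 4.10 (c); [SerreGaloisCohomology1997] I §2.5, II §4.4 Prop. 13; [NeukirchSchmidtWingberg2008]
I §5 Prop. (1.5.3).
-/

set_option autoImplicit false
-- the Theorems namespace of this sub repeats the summit name by design (D-0017 nested layout)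
set_option linter.dupNamespace false

noncomputable section

open CategoryTheory Function NumberField Field
open _root_.TopRep _root_.ContRepresentation _root_.ContinuousCohomology
open Literature.NumberTheory.GaloisRepresentations
open Literature.NumberTheory.GaloisRepresentations.LocalWeilDatum

namespace Summit.BirchSwinnertonDyer.BirchSwinnertonDyer.Theorems.SignedEC.ShaThreeBase

section NumberField

variable {F : Type} [Field F] [NumberField F]
variable {T : Type} [AddCommGroup T] [TopologicalSpace T] [DiscreteTopology T]
variable (σT : DiscreteGaloisModule F T)

omit [NumberField F] in
/-- `(Iε)² = -e` for `I² = -1`, `ε² = e`. [folklore] -/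
theorem mul_I_sq_eq {I ε : AlgebraicClosure F} {e : F} (hI : I * I = -1) (hε : ε * ε = algebraMap F _ e) :
    (I * ε) * (I * ε) = algebraMap F _ (-e) := by
  rw [mul_mul_mul_comm, hI, hε, map_neg, neg_one_mul]

/-- **A class of `H²(F, T)` dying on `Γ_{F(√e)}` is a corestriction from `Γ_{F(√-e)}`** (`T` trivial with `2T = 0`; `ε² = e`,
`ε ∉ F`; `I² = -1`, `Iε ∉ F`): the Gysin decomposition `y = [φ] ∪ [χ_U]` on `U = Γ_{F(ε)}` (`mem_range_cor_of_resH_two_eq_zero`)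
with `[χ_U] = κ(e) = cor_{Γ_{F(Iε)}} κ(Iε)` (`cor_quadraticKummer_eq` at `δ = Iε`, `δ² = -e`; `cores = cor` in degree `1`).
[cite: SerreGaloisCohomology1997, I §2.5] [cite: NeukirchSchmidtWingberg2008, I §5 Prop. (1.5.3) (iv)] -/
theorem mem_range_cor_of_resH_galFixing_eq_zero (htriv : ∀ (x : absoluteGaloisGroup F) (t : T), σT x t = t)
    (h2 : ∀ t : T, 2 • t = 0) (e : F) (ε : AlgebraicClosure F) (hε : ε * ε = algebraMap F _ e)
    (hεF : ε ∉ (algebraMap F (AlgebraicClosure F)).range) (I : AlgebraicClosure F) (hI : I * I = -1)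
    (hIεF : I * ε ∉ (algebraMap F (AlgebraicClosure F)).range)
    [Fintype (absoluteGaloisGroup F ⧸ galFixing F (IntermediateField.adjoin F {I * ε}))]
    [IsClosed (galFixing F (IntermediateField.adjoin F {I * ε}) : Set (absoluteGaloisGroup F))]
    (y : galoisCohomology σT 2) (hy : resH (galFixing F (IntermediateField.adjoin F {ε})) σT 2 y = 0) :
    y ∈ Set.range (cor (galFixing F (IntermediateField.adjoin F {I * ε})) σT 2) := by
  classical
  -- the open index-`2` subgroup `U = Γ_{F(ε)}`
  have hUo : IsOpen (galFixing F (IntermediateField.adjoin F {ε}) : Set (absoluteGaloisGroup F)) := isOpen_galFixing_adjoin ε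
  have hUidx : (galFixing F (IntermediateField.adjoin F {ε})).index = 2 := index_galFixing_adjoin_eq_two e ε hε hεF
  haveI : Fintype (absoluteGaloisGroup F ⧸ galFixing F (IntermediateField.adjoin F {ε})) :=
    Subgroup.fintypeOfIndexNeZero (by rw [hUidx]; exact two_ne_zero)
  -- `δ = Iε`, `δ² = -e`, `γ² = δ`
  have hδ : (I * ε) * (I * ε) = algebraMap F _ (-e) := mul_I_sq_eq hI hε
  obtain ⟨γ, hγ'⟩ := IsAlgClosed.exists_eq_mul_self (I * ε)
  have hγ : γ * γ = I * ε := hγ'.symm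
  have hε0 : ε ≠ 0 := fun h => hεF ⟨0, by rw [map_zero, h]⟩
  have hI0 : I ≠ 0 := fun h => by rw [h, mul_zero] at hI; exact one_ne_zero (neg_eq_zero.1 hI.symm)
  have hδ0 : I * ε ≠ 0 := mul_ne_zero hI0 hε0
  have hγ0 : γ ≠ 0 := fun h => hδ0 (by rw [← hγ, h, mul_zero])
  -- `I δ = -ε`
  have hIδ : I * (I * ε) = -ε := by rw [← mul_assoc, hI, neg_one_mul]
  have hx : (I * (I * ε)) * (I * (I * ε)) = algebraMap F _ e := by rw [hIδ, neg_mul_neg, hε]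
  have hx0 : I * (I * ε) ≠ 0 := by rw [hIδ]; exact neg_ne_zero.2 hε0
  -- the quadratic character `χ` of `F(Iδ) = F(ε)` and the Kummer character `u` of `Γ_{F(δ)}`
  obtain ⟨χ, hχ⟩ := exists_quadraticCocycle (I * (I * ε)) e hx hx0
  obtain ⟨u, hu⟩ := exists_quadraticCocycle_subgroup (I * ε) γ hγ hγ0
  have hcores := cor_quadraticKummer_eq I (I * ε) γ (-e) hI hδ hIεF hγ χ hχ u hu
  -- `χ` cuts out `U`
  have hχU : ∀ σ : absoluteGaloisGroup F, χ.1 σ = 0 ↔ σ ∈ galFixing F (IntermediateField.adjoin F {ε}) := by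
    intro σ
    rw [hχ σ, mem_galFixing_adjoin_simple_iff ε σ, hIδ, smul_neg, neg_inj]
    by_cases h : σ • ε = ε
    · simp only [h, if_true]
    · simp only [h, if_false, iff_false]
      exact one_ne_zero
  -- `[χ] = cor_{S'} [u]` for the Shapiro corestriction
  have hu' : oneCocycleClass _ χ ∈
      Set.range (cor (galFixing F (IntermediateField.adjoin F {I * ε}))
        (ContinuousRep.trivial (absoluteGaloisGroup F) ℤ (ZMod 2)) 1) := by
    refine ⟨oneCocycleClass _ u, ?_⟩
    rw [← cores_eq_cor (galFixing F (IntermediateField.adjoin F {I * ε}))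
      (ContinuousRep.trivial (absoluteGaloisGroup F) ℤ (ZMod 2)) (isOpen_galFixing_adjoin (I * ε))]
    exact hcores
  exact mem_range_cor_of_resH_two_eq_zero σT htriv h2 hUo hUidx χ hχU
    (galFixing F (IntermediateField.adjoin F {I * ε})) hu' y hy

omit [NumberField F] in
/-- A non-square root: if `x² = a` with `φ a < 0` for some ring homomorphism `φ : F → ℝ`, then `x ∉ F`. [folklore] -/
theorem not_mem_range_of_sq_neg {x : AlgebraicClosure F} {a : F} (hx : x * x = algebraMap F _ a) (φ : F →+* ℝ)
    (ha : φ a < 0) : x ∉ (algebraMap F (AlgebraicClosure F)).range := by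
  rintro ⟨d, hd⟩
  have hdd : d * d = a := (algebraMap F (AlgebraicClosure F)).injective (by rw [map_mul, hd, hx])
  have h := mul_self_nonneg (φ d)
  rw [← map_mul, hdd] at h
  exact absurd ha (not_lt.2 h)

/-- **Base case of Milne I Thm. 4.10 (c)₃ from the displayed binder (hDie).**  Let `T` be a discrete `Γ_F`-module with
trivial action and `2T = 0`.  Suppose every class `y ∈ H²(F, T)` vanishing at all real places DIES on `Γ_{F(√e)}` for some
totally positive non-square `e ∈ F` (depending on `y`).  Then every class of `H³(F, T)` vanishing at all real places is `0`.
(Totally complex `F`: `cd₂(Γ_F) ≤ 2`, `…ShaThreeBaseOfNorm.realThree_eq_zero_of_groupCdLE`.  Otherwise a real embedding `φ₀`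
exists, `-e` is negative at every real embedding, `Iε ∉ F`, `F(Iε)` is totally complex so `cd₂(Γ_{F(Iε)}) ≤ 2`; `y` is a
norm from `Γ_{F(Iε)}` (`mem_range_cor_of_resH_galFixing_eq_zero`), hence from `Γ_{F(I)}` (B7
`range_cor_galFixing_adjoin_subset_of_neg`), and `realThree_injective_of_norm_imaginary` concludes.)
[cite: MilneADT2006, Ch. I, Thm. 4.10 (c)] [cite: SerreGaloisCohomology1997, II §4.4 Prop. 13] -/
theorem realThree_injective_orderTwo_of_dies (htriv : ∀ (x : absoluteGaloisGroup F) (t : T), σT x t = t)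
    (h2 : ∀ t : T, 2 • t = 0)
    (hDie : ∀ y : galoisCohomology σT 2,
      (∀ w : InfinitePlace F, w.IsReal → galoisCohomology.localization σT (Sum.inl w) 2 y = 0) →
        ∃ (e : F) (ε : AlgebraicClosure F), ε * ε = algebraMap F _ e ∧ (∀ φ : F →+* ℝ, 0 < φ e) ∧
          ε ∉ (algebraMap F (AlgebraicClosure F)).range ∧
          resH (galFixing F (IntermediateField.adjoin F {ε})) σT 2 y = 0)
    (c : galoisCohomology σT 3)
    (hc : ∀ w : InfinitePlace F, w.IsReal → galoisCohomology.localization σT (Sum.inl w) 3 c = 0) : c = 0 := by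
  classical
  by_cases htc : IsTotallyComplex F
  · -- totally complex: `cd₂(Γ_F) ≤ 2`
    haveI : Fact (Nat.Prime 2) := ⟨Nat.prime_two⟩
    exact realThree_eq_zero_of_groupCdLE σT h2 (fieldCdLE_two_of_numberField_holds F 2 (Or.inr htc)) c
  · -- a real embedding `φ₀`
    obtain ⟨w₀, hw₀⟩ : ∃ w : InfinitePlace F, w.IsReal := by
      by_contra hno
      push Not at hno
      exact htc ⟨fun v => (InfinitePlace.not_isReal_iff_isComplex).1 (hno v)⟩
    let φ₀ : F →+* ℝ := InfinitePlace.embedding_of_isReal hw₀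
    refine realThree_injective_of_norm_imaginary σT htriv h2 (fun I hI hIF _ _ y hy => ?_) c hc
    obtain ⟨e, ε, hε, hpos, hεF, hyU⟩ := hDie y hy
    have hneg : ∀ φ : F →+* ℝ, φ (-e) < 0 := fun φ => by rw [map_neg, neg_lt_zero]; exact hpos φ
    have hδ : (I * ε) * (I * ε) = algebraMap F _ (-e) := mul_I_sq_eq hI hε
    have hIεF : I * ε ∉ (algebraMap F (AlgebraicClosure F)).range := not_mem_range_of_sq_neg hδ φ₀ (hneg φ₀)
    -- `S' = Γ_{F(Iε)}`: open of index `2`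
    have hS'idx : (galFixing F (IntermediateField.adjoin F {I * ε})).index = 2 :=
      index_galFixing_adjoin_eq_two (-e) (I * ε) hδ hIεF
    haveI : Fintype (absoluteGaloisGroup F ⧸ galFixing F (IntermediateField.adjoin F {I * ε})) :=
      Subgroup.fintypeOfIndexNeZero (by rw [hS'idx]; exact two_ne_zero)
    haveI : IsClosed (galFixing F (IntermediateField.adjoin F {I * ε}) : Set (absoluteGaloisGroup F)) :=
      Subgroup.isClosed_of_isOpen _ (isOpen_galFixing_adjoin (I * ε))
    exact range_cor_galFixing_adjoin_subset_of_neg σT htriv h2 (-e) (I * ε) hδ hneg hIεF I hI hIF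
      (mem_range_cor_of_resH_galFixing_eq_zero σT htriv h2 e ε hε hεF I hI hIεF y hyU)

end NumberField

/-! ## The registered stub from the displayed binder, all number fields and all `T` of order `2` -/

section Stub

/-- In a group of order `2`, `2 • t = 0`. [folklore] -/
theorem two_nsmul_eq_zero_of_natCard_eq_two {T : Type} [AddCommGroup T] (hT : Nat.card T = 2) (t : T) : 2 • t = 0 := by
  have h := card_nsmul_eq_zero' (x := t)
  rwa [hT] at h

/-- **`stub_realThreeOrderTwoBase` (skeleton `Lines/eulerchar.lean` v15, VERBATIM signature) from the displayed binder (hDie)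
for every number field and every trivial module of order `2`**: the `hbase` road assembled (`realThree_injective_orderTwo_of_dies`;
`2T = 0` from `Nat.card T = 2`).  The binder (hDie) — «every real-trivial class of `H²(F, T)` dies on `Γ_{F(√e)}` for some
totally positive non-square `e`» — is Brauer–Hasse–Noether for the quadratic extension `F(√e)/F` applied to a class with finite
support (bricks B1–B3 of the road). [cite: MilneADT2006, Ch. I, Thm. 4.10 (c)] [cite: CasselsFrohlichANT1967, Ch. VII §10] -/
theorem stub_realThreeOrderTwoBase_of_dies
    (hDie : ∀ (F : Type) [Field F] [NumberField F] (T : Type) [AddCommGroup T] [TopologicalSpace T]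
      [DiscreteTopology T] [Finite T] (σ : DiscreteGaloisModule F T),
      (∀ (g : Field.absoluteGaloisGroup F) (t : T), σ g t = t) → Nat.card T = 2 →
        ∀ y : galoisCohomology σ 2,
          (∀ w : NumberField.InfinitePlace F, w.IsReal → galoisCohomology.localization σ (Sum.inl w) 2 y = 0) →
            ∃ (e : F) (ε : AlgebraicClosure F), ε * ε = algebraMap F _ e ∧ (∀ φ : F →+* ℝ, 0 < φ e) ∧
              ε ∉ (algebraMap F (AlgebraicClosure F)).range ∧
              resH (galFixing F (IntermediateField.adjoin F {ε})) σ 2 y = 0) :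
    ∀ (F : Type) [Field F] [NumberField F] (T : Type) [AddCommGroup T] [TopologicalSpace T]
      [DiscreteTopology T] [Finite T] (σ : DiscreteGaloisModule F T),
      (∀ (g : Field.absoluteGaloisGroup F) (t : T), σ g t = t) → Nat.card T = 2 →
        ∀ c : galoisCohomology σ 3,
          (∀ w : NumberField.InfinitePlace F, w.IsReal →
            galoisCohomology.localization σ (Sum.inl w) 3 c = 0) → c = 0 := by
  intro F _ _ T _ _ _ _ σ htriv hcard c hc
  exact realThree_injective_orderTwo_of_dies σ htriv (two_nsmul_eq_zero_of_natCard_eq_two hcard)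
    (hDie F T σ htriv hcard) c hc

end Stub

end Summit.BirchSwinnertonDyer.BirchSwinnertonDyer.Theorems.SignedEC.ShaThreeBase

end
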